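import Summits.QuantumFields.BalabanUV.Beta.EriceRemainderEnclosureHistoryRenewalWitness

/-!
# EriceRemainderEnclosureHistoryRenewalWitnessMonotone — (E35e) the MONOTONE variant of the digital witness, part 1: STEP profiles
# (each age profile ONE non-increasing step of height `ε_t ≤ cθ^{a_t−1}` — sign-coherent memory of bounded variation), the two runs with
# PLATEAU shifts, and the separation: the step of stage `t` reads `1` at the indices `≥ k_t + 1 − a_t` of BOTH runs and `0` below

Cell `pub-balaban`, β-function sub-cell, BINDER row D4 «RemainderConst leaves for Bałaban's split» (`HOME/BINDER-OWNERS.md`; owner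
lineage `b2b-balaban-beta-an4`; this file by co-owner #2 lineage `b2b-balaban-beta-d4-p2`, generation 37), β-FLOW TEAM duty (1),
FREEZE (0) honoured (def-free; no new leaf, no new hypothesis shape — the extra property «antitone in every past coupling» is stated as
a plain proposition in part 2).  Part 5 of station (E35) over part 1 `EriceRemainderEnclosureHistoryRenewalWitness` (amplitudes,
accumulated firing `W`, grid, `abs_sub_le_cube_mul_abs_invSqrt_sub`).

HONEST FRAMING (page 1, verbatim and binding).  *"Discharging BetaPertH makes Bałaban's UV stability UNCONDITIONAL — a real
constructive-QFT result; it is NOT the continuum limit and NOT the Clay problem."*  THIS FILE DISCHARGES NOTHING OF THE KIND.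
[folklore] real analysis on an EXPLICIT family and two EXPLICIT runs; a WITNESS about the cell's own NOT-IN-PRINT binders (GAPS
G-t4-U2-1∕-2), never an assertion about Bałaban's (1.22).  Row D4 class UNCHANGED (critical-path width 0; instance 0∕1; D4 DISCHARGE NO
DATE); NOT B12 Thm 2, NOT BetaPertH, NOT continuum, NOT Clay.  HONEST DEPENDENCY: continuum YM on T⁴ ⇐ BetaPertH ∧ nine spine estimates
(0/9 proved); BetaPertH ⇐ (D1) ∧ (D4) ∧ CAP+tail; G-an2-4 gates asym, D1 and NE2/3/4.

THE POINT (census sense (α)).  Gen 36's β-numerics and research note suggested that SIGN-COHERENT (monotone-along-chain) memory —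
(E33e)'s clipped ramps gave «exactly θ^j» — might keep node U2's geometric shape without `FadingMemory`, because the history shifts
then TELESCOPE across cutoffs.  Parts 1–4 used TENT profiles (one swing up and down).  This part replaces them by monotone STEPS:
`β_{k+1}(v) = B₀ − Σ_t [a_t ≤ k]·ε_t·step_t(v_{k−a_t})`, `step_t(x) = min 1 (max 0 (L_t(x − q_t)))`, so `β_{k+1}` is ANTITONE in
every past coupling and each age profile has total variation `ε_t`.  A step cannot single out ONE read point; instead it reads `1` at
EVERY point with coupling above the threshold — i.e. at all indices `i ≥ i_t := k_t + 1 − a_t` of BOTH runs — and `0` below, so both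
runs pick up the same PLATEAU shifts `PA i = Σ_t ε_t·(K − max(i, k_t+1))`, `PB i = Σ_t ε_t·(K+1 − max(i, k_t+1))`, and the two-run
discrepancy is the same accumulated firing `W` as before: `yA i − yB(i+1) = W(i+1)` (§2 `run_facts`).  The threshold `q_t =
1∕√(yB(i_t) + η_t)` sits between run B's value `yB(i_t)` (reads `1`) and run A's value `yA(i_t − 1) = yB(i_t) + W(i_t) ≥ yB(i_t) + ε_{t−1}`
at the same infrared distance (reads `0`); everything else is farther away (values antitone in the index by steps `≥ b`, `yA + b ≤ yB`
at equal index) — §3 `step_values`.  So the adversary is the PLACEMENT of the step between the two runs' matched couplings, not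
oscillation; part 6 `…WitnessMonotoneRate` concludes.

WHAT IS PROVED (0 `def`, 0 sorry; [folklore]).  §1 steps (`step_nonneg` ∕ `step_le_one` ∕ `step_eq_zero` ∕ `step_eq_one` ∕ `step_mono` ∕
`abs_step_sub_step_le`); §2 `plateau_facts`, `run_facts`; §3 `step_values`.
-/

noncomputable section
open Finset

namespace Summit.QuantumFields.BalabanUV.Beta.EriceRemainderEnclosureHistoryRenewalWitnessMonotone

open Literature.MathematicalPhysics.QuantumFieldTheory.Balaban1983to89
open Literature.MathematicalPhysics.QuantumFieldTheory.Balaban1983to89.FlowStep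
open Literature.MathematicalPhysics.QuantumFieldTheory.Balaban1983to89.T4CouplingMatching
open Summit.QuantumFields.BalabanUV.Beta.EriceRemainderEnclosureHistoryRenewalWitness

/-! ## §1 Step profiles -/

/-- Step profiles are nonnegative. [folklore] -/
theorem step_nonneg (L q x : ℝ) : 0 ≤ min 1 (max 0 (L * (x - q))) := le_min zero_le_one (le_max_left _ _)

/-- Step profiles are at most `1`. [folklore] -/
theorem step_le_one (L q x : ℝ) : min 1 (max 0 (L * (x - q))) ≤ 1 := min_le_left _ _

/-- Below the threshold the step is `0` (`L ≥ 0`). [folklore] -/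
theorem step_eq_zero {L q x : ℝ} (hL : 0 ≤ L) (h : x ≤ q) : min 1 (max 0 (L * (x - q))) = 0 := by
  rw [max_eq_left (by nlinarith), min_eq_right zero_le_one]

/-- One slope-width above the threshold the step is `1`. [folklore] -/
theorem step_eq_one {L q x : ℝ} (h : 1 ≤ L * (x - q)) : min 1 (max 0 (L * (x - q))) = 1 :=
  min_eq_left (le_max_of_le_right h)

/-- Step profiles are monotone (`L ≥ 0`). [folklore] -/
theorem step_mono {L q x y : ℝ} (hL : 0 ≤ L) (h : x ≤ y) : min 1 (max 0 (L * (x - q))) ≤ min 1 (max 0 (L * (y - q))) :=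
  min_le_min le_rfl (max_le_max le_rfl (by nlinarith))

/-- The step of slope `L ≥ 0` is `L`-Lipschitz. [folklore] -/
theorem abs_step_sub_step_le {L : ℝ} (hL : 0 ≤ L) (q x y : ℝ) :
    |min 1 (max 0 (L * (x - q))) - min 1 (max 0 (L * (y - q)))| ≤ L * |x - y| := by
  have h1 : |max 0 (L * (x - q)) - max 0 (L * (y - q))| ≤ L * |x - y| := by
    rw [max_comm 0 (L * (x - q)), max_comm 0 (L * (y - q))]
    refine (abs_max_sub_max_le_abs _ _ _).trans ?_
    rw [← mul_sub, abs_mul, abs_of_nonneg hL, show x - q - (y - q) = x - y by ring]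
  exact (abs_min_sub_min_le_max _ _ _ _).trans (max_le (by simp; positivity) h1)

/-! ## §2 The two runs with plateau shifts -/

/-- THE PLATEAU SHIFTS `PA i = Σ_t ε_t·(K − max(i, k_t+1))`, `PB i = Σ_t ε_t·(K+1 − max(i, k_t+1))` (truncated subtraction; `K = k_s+1`):
both `≥ 0`; `0 ≤ PB i − PA i ≤ S` for `i ≤ K`; one-step drops `PA i − PA(i+1) ≤ S`, `PB i − PB(i+1) ≤ S` and `= Σ_t [k_t+1 ≤ i] ε_t`
(for `i < K`, resp. `i ≤ K`); the cross difference `PB(i+1) − PA i = W(i+1)`; and `PA i = PB i = 0` past the cutoff. [folklore] -/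
theorem plateau_facts {c θ : ℝ} {s K : ℕ} {a k : ℕ → ℕ} {ε W PA PB : ℕ → ℝ} {S : ℝ} (hc : 0 < c) (hθ0 : 0 < θ)
    (hε : ∀ t, ε t = c * θ ^ (a t - 1) / (s + 1)) (hS : S = ∑ t ∈ range (s + 1), ε t) (hK : K = k s + 1)
    (hW : ∀ i, W i = ∑ t ∈ range (s + 1), if i ≤ k t + 1 then ε t else 0)
    (hPA : ∀ i, PA i = ∑ t ∈ range (s + 1), ε t * ((K - max i (k t + 1) : ℕ) : ℝ))
    (hPB : ∀ i, PB i = ∑ t ∈ range (s + 1), ε t * ((K + 1 - max i (k t + 1) : ℕ) : ℝ))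
    (hks : ∀ t, t ≤ s → k t ≤ k s) :
    (∀ i, 0 ≤ PA i) ∧ (∀ i, 0 ≤ PB i) ∧ (∀ i, i ≤ K → 0 ≤ PB i - PA i ∧ PB i - PA i ≤ S) ∧
    (∀ i, i < K → PA i - PA (i + 1) = ∑ t ∈ range (s + 1), if k t + 1 ≤ i then ε t else 0) ∧
    (∀ i, i ≤ K → PB i - PB (i + 1) = ∑ t ∈ range (s + 1), if k t + 1 ≤ i then ε t else 0) ∧
    (∀ i, (0 : ℝ) ≤ ∑ t ∈ range (s + 1), (if k t + 1 ≤ i then ε t else 0) ∧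
      ∑ t ∈ range (s + 1), (if k t + 1 ≤ i then ε t else 0) ≤ S) ∧
    (∀ i, PB (i + 1) - PA i = W (i + 1)) ∧ (∀ i, K ≤ i → PA i = 0) ∧ (∀ i, K + 1 ≤ i → PB i = 0) := by
  have hp := eps_pos hc hθ0 hε
  have hmem : ∀ t, t ∈ range (s + 1) → t ≤ s := fun t ht => Nat.lt_succ_iff.mp (mem_range.mp ht)
  have hite : ∀ (P : ℕ → Prop) [DecidablePred P] (i : ℕ), (0 : ℝ) ≤ ∑ t ∈ range (s + 1), (if P t then ε t else 0) ∧
      ∑ t ∈ range (s + 1), (if P t then ε t else 0) ≤ S := by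
    intro P _ i
    constructor
    · exact sum_nonneg fun t _ => by split_ifs <;> [exact (hp t).le; exact le_rfl]
    · rw [hS]; exact sum_le_sum fun t _ => by split_ifs <;> [exact le_rfl; exact (hp t).le]
  refine ⟨fun i => ?_, fun i => ?_, fun i hi => ?_, fun i hi => ?_, fun i hi => ?_, fun i => hite _ i, fun i => ?_, fun i hi => ?_,
    fun i hi => ?_⟩
  · rw [hPA]; exact sum_nonneg fun t _ => mul_nonneg (hp t).le (Nat.cast_nonneg _)
  · rw [hPB]; exact sum_nonneg fun t _ => mul_nonneg (hp t).le (Nat.cast_nonneg _)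
  · have e : PB i - PA i = ∑ t ∈ range (s + 1), if max i (k t + 1) ≤ K then ε t else 0 := by
      rw [hPB, hPA, ← sum_sub_distrib]
      refine sum_congr rfl fun t ht => ?_
      have := hks t (hmem t ht)
      split_ifs with h
      · rw [← mul_sub, show ((K + 1 - max i (k t + 1) : ℕ) : ℝ) - ((K - max i (k t + 1) : ℕ) : ℝ) = 1 by
          rw [show K + 1 - max i (k t + 1) = (K - max i (k t + 1)) + 1 by omega]; push_cast; ring, mul_one]
      · omega
    rw [e]; exact hite _ i
  · rw [hPA, hPA, ← sum_sub_distrib]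
    refine sum_congr rfl fun t ht => ?_
    have := hks t (hmem t ht)
    split_ifs with h
    · rw [← mul_sub, show ((K - max i (k t + 1) : ℕ) : ℝ) - ((K - max (i + 1) (k t + 1) : ℕ) : ℝ) = 1 by
        rw [show max i (k t + 1) = i by omega, show max (i + 1) (k t + 1) = i + 1 by omega,
          show K - i = (K - (i + 1)) + 1 by omega]; push_cast; ring, mul_one]
    · rw [← mul_sub, show max i (k t + 1) = k t + 1 by omega, show max (i + 1) (k t + 1) = k t + 1 by omega, sub_self, mul_zero]
  · rw [hPB, hPB, ← sum_sub_distrib]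
    refine sum_congr rfl fun t ht => ?_
    have := hks t (hmem t ht)
    split_ifs with h
    · rw [← mul_sub, show ((K + 1 - max i (k t + 1) : ℕ) : ℝ) - ((K + 1 - max (i + 1) (k t + 1) : ℕ) : ℝ) = 1 by
        rw [show max i (k t + 1) = i by omega, show max (i + 1) (k t + 1) = i + 1 by omega,
          show K + 1 - i = (K + 1 - (i + 1)) + 1 by omega]; push_cast; ring, mul_one]
    · rw [← mul_sub, show max i (k t + 1) = k t + 1 by omega, show max (i + 1) (k t + 1) = k t + 1 by omega, sub_self, mul_zero]
  · rw [hPB, hPA, hW, ← sum_sub_distrib]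
    refine sum_congr rfl fun t ht => ?_
    have := hks t (hmem t ht)
    split_ifs with h
    · rw [← mul_sub, show ((K + 1 - max (i + 1) (k t + 1) : ℕ) : ℝ) - ((K - max i (k t + 1) : ℕ) : ℝ) = 1 by
        rw [show K + 1 - max (i + 1) (k t + 1) = (K - max i (k t + 1)) + 1 by omega]; push_cast; ring, mul_one]
    · rw [← mul_sub, show max (i + 1) (k t + 1) = i + 1 by omega, show max i (k t + 1) = i by omega,
        show K + 1 - (i + 1) = K - i by omega, sub_self, mul_zero]
  · rw [hPA]; exact sum_eq_zero fun t _ => by rw [show K - max i (k t + 1) = 0 by omega]; simp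
  · rw [hPB]; exact sum_eq_zero fun t _ => by rw [show K + 1 - max i (k t + 1) = 0 by omega]; simp

/-- THE TWO RUNS' RECURSION VALUES `yA i = Y(K−i) − PA i`, `yB i = Y(K+1−i) − PB i`: both antitone in the index (by at least `b` per
step below the cutoff), `yA i + b ≤ yB i` (`i ≤ K`), `yA i − yB(i+1) = W(i+1)` (the points interleave), and all values lie in
`[x⋆, Ytop − b]` with `Ytop = x⋆ + (b+c)(k_s+2) + b`. [folklore] -/
theorem run_facts {c θ γ b : ℝ} {s K : ℕ} {a k : ℕ → ℕ} {ε W PA PB Y yA yB : ℕ → ℝ} {S B₀ xs Ytop : ℝ}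
    (hc : 0 < c) (hθ0 : 0 < θ) (hθ1 : θ ≤ 1) (hγ : 0 < γ) (hb : 0 < b)
    (hε : ∀ t, ε t = c * θ ^ (a t - 1) / (s + 1)) (hS : S = ∑ t ∈ range (s + 1), ε t) (hB : B₀ = b + S)
    (hx : xs = 1 / γ ^ 2) (hY : ∀ m : ℕ, Y m = xs + B₀ * m) (hK : K = k s + 1)
    (hW : ∀ i, W i = ∑ t ∈ range (s + 1), if i ≤ k t + 1 then ε t else 0)
    (hPA : ∀ i, PA i = ∑ t ∈ range (s + 1), ε t * ((K - max i (k t + 1) : ℕ) : ℝ))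
    (hPB : ∀ i, PB i = ∑ t ∈ range (s + 1), ε t * ((K + 1 - max i (k t + 1) : ℕ) : ℝ))
    (hT : Ytop = xs + (b + c) * (k s + 2) + b) (hyA : ∀ i, yA i = Y (K - i) - PA i) (hyB : ∀ i, yB i = Y (K + 1 - i) - PB i)
    (hks : ∀ t, t ≤ s → k t ≤ k s) :
    (∀ i j, i ≤ j → yA j ≤ yA i) ∧ (∀ i j, i ≤ j → yB j ≤ yB i) ∧
    (∀ i, i < K → yA (i + 1) + b ≤ yA i) ∧ (∀ i, i ≤ K → yB (i + 1) + b ≤ yB i) ∧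
    (∀ i, i ≤ K → yA i + b ≤ yB i) ∧ (∀ i, yA i - yB (i + 1) = W (i + 1)) ∧
    (∀ i, xs ≤ yA i ∧ yA i + b ≤ Ytop) ∧ (∀ i, xs ≤ yB i ∧ yB i + b ≤ Ytop) := by
  obtain ⟨Y0, hT0⟩ : ∃ Y0 : ℝ, Y0 = xs + (b + c) * (k s + 2) := ⟨_, rfl⟩
  obtain ⟨hxs, hB0, hB1, hYlo, hYhi, -, hYsucc⟩ := grid_bounds hc hθ0 hθ1 hγ hb hε hS hB hx hY hT0
  have hTT : Ytop = Y0 + b := by rw [hT, hT0]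
  obtain ⟨hPA0, hPB0, hdiff, hstepA, hstepB, hite, hcross, hPAz, hPBz⟩ := plateau_facts hc hθ0 hε hS hK hW hPA hPB hks
  have hSB : S = B₀ - b := by rw [hB]; ring
  -- one step
  have hA1 : ∀ i, yA (i + 1) ≤ yA i := by
    intro i; rw [hyA, hyA]
    by_cases hi : i < K
    · rw [show K - i = (K - (i + 1)) + 1 by omega, hYsucc]
      have h1 := hstepA i hi; have h2 := (hite i).2; linarith
    · rw [show K - (i + 1) = 0 by omega, show K - i = 0 by omega, hPAz i (by omega), hPAz (i + 1) (by omega)]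
  have hB1' : ∀ i, yB (i + 1) ≤ yB i := by
    intro i; rw [hyB, hyB]
    by_cases hi : i ≤ K
    · rw [show K + 1 - i = (K + 1 - (i + 1)) + 1 by omega, hYsucc]
      have h1 := hstepB i hi; have h2 := (hite i).2; linarith
    · rw [show K + 1 - (i + 1) = 0 by omega, show K + 1 - i = 0 by omega, hPBz i (by omega), hPBz (i + 1) (by omega)]
  have hAanti : ∀ i j, i ≤ j → yA j ≤ yA i := by
    intro i j hij
    induction j, hij using Nat.le_induction with
    | base => exact le_rfl
    | succ n _ ih => exact (hA1 n).trans ih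
  have hBanti : ∀ i j, i ≤ j → yB j ≤ yB i := by
    intro i j hij
    induction j, hij using Nat.le_induction with
    | base => exact le_rfl
    | succ n _ ih => exact (hB1' n).trans ih
  refine ⟨hAanti, hBanti, fun i hi => ?_, fun i hi => ?_, fun i hi => ?_, fun i => ?_, fun i => ⟨?_, ?_⟩, fun i => ⟨?_, ?_⟩⟩
  · rw [hyA, hyA, show K - i = (K - (i + 1)) + 1 by omega, hYsucc]
    have h1 := hstepA i hi; have h2 := (hite i).2; linarith
  · rw [hyB, hyB, show K + 1 - i = (K + 1 - (i + 1)) + 1 by omega, hYsucc]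
    have h1 := hstepB i hi; have h2 := (hite i).2; linarith
  · rw [hyA, hyB, show K + 1 - i = (K - i) + 1 by omega, hYsucc]
    have h1 := (hdiff i hi).2; linarith
  · rw [hyA, hyB, show K + 1 - (i + 1) = K - i by omega, ← hcross i]; ring
  · have h1 := hAanti i (i + K) (Nat.le_add_right i K)
    have h2 : yA (i + K) = xs := by
      rw [hyA, show K - (i + K) = 0 by omega, hPAz (i + K) (by omega), hY]; push_cast; ring
    linarith
  · rw [hyA, hTT]
    have h1 := hYhi (K - i) (by omega); have h2 := hPA0 i; linarith
  · have h1 := hBanti i (i + (K + 1)) (Nat.le_add_right i (K + 1))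
    have h2 : yB (i + (K + 1)) = xs := by
      rw [hyB, show K + 1 - (i + (K + 1)) = 0 by omega, hPBz (i + (K + 1)) (by omega), hY]; push_cast; ring
    linarith
  · rw [hyB, hTT]
    have h1 := hYhi (K + 1 - i) (by omega); have h2 := hPB0 i; linarith

/-! ## §3 Separation: the step of stage `t` reads `1` at the indices `≥ i_t = k_t + 1 − a_t` of BOTH runs and `0` below -/

/-- **STEP VALUES ALONG THE RUNS.**  The step of stage `t` — threshold `q_t = 1∕√(yB(i_t) + η_t)` (`η_0 = b`, `η_{u+1} = ε_u`), slope
`L_t = (1 + Ytop)³∕η_t` — reads `1` at every index `i ≥ i_t := k_t + 1 − a_t` of both runs (their recursion values are `≤ yB(i_t)`,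
hence their couplings are `≥ 1∕√(yB i_t) ≥ q_t + 1∕L_t`) and `0` at every index `i < i_t` (values `≥ yB(i_t) + W(i_t) ≥ yB(i_t) + η_t`,
couplings `≤ q_t`). [folklore] -/
theorem step_values {c θ γ b : ℝ} {s K : ℕ} {a k : ℕ → ℕ} {ε W PA PB Y yA yB η L q gA gB : ℕ → ℝ} {S B₀ xs Ytop : ℝ}
    (hc : 0 < c) (hθ0 : 0 < θ) (hθ1 : θ ≤ 1) (hγ : 0 < γ) (hb : 0 < b)
    (hε : ∀ t, ε t = c * θ ^ (a t - 1) / (s + 1)) (hS : S = ∑ t ∈ range (s + 1), ε t) (hB : B₀ = b + S)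
    (hx : xs = 1 / γ ^ 2) (hY : ∀ m : ℕ, Y m = xs + B₀ * m) (hK : K = k s + 1)
    (hW : ∀ i, W i = ∑ t ∈ range (s + 1), if i ≤ k t + 1 then ε t else 0)
    (hPA : ∀ i, PA i = ∑ t ∈ range (s + 1), ε t * ((K - max i (k t + 1) : ℕ) : ℝ))
    (hPB : ∀ i, PB i = ∑ t ∈ range (s + 1), ε t * ((K + 1 - max i (k t + 1) : ℕ) : ℝ))
    (hT : Ytop = xs + (b + c) * (k s + 2) + b) (hyA : ∀ i, yA i = Y (K - i) - PA i) (hyB : ∀ i, yB i = Y (K + 1 - i) - PB i)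
    (hη0 : η 0 = b) (hηs : ∀ t, η (t + 1) = ε t) (hL : ∀ t, L t = (1 + Ytop) ^ 3 / η t)
    (hq : ∀ t, q t = 1 / Real.sqrt (yB (k t + 1 - a t) + η t))
    (hgA : ∀ i, gA i = 1 / Real.sqrt (yA i)) (hgB : ∀ i, gB i = 1 / Real.sqrt (yB i))
    (ha0 : a 0 = k 0 + 1) (hak : ∀ t, t < s → k (t + 1) = k t + a (t + 1)) (hks : ∀ t, t ≤ s → k t ≤ k s)
    (hεb : ∀ t, t ≤ s → ε t ≤ b) {t : ℕ} (ht : t ≤ s) :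
    (∀ i, k t + 1 - a t ≤ i → min 1 (max 0 (L t * (gA i - q t))) = 1 ∧ min 1 (max 0 (L t * (gB i - q t))) = 1) ∧
    (∀ i, i < k t + 1 - a t → min 1 (max 0 (L t * (gA i - q t))) = 0 ∧ min 1 (max 0 (L t * (gB i - q t))) = 0) := by
  obtain ⟨hAanti, hBanti, hAstep, hBstep, hAB, hcross, hAbd, hBbd⟩ :=
    run_facts hc hθ0 hθ1 hγ hb hε hS hB hx hY hK hW hPA hPB hT hyA hyB hks
  obtain ⟨hxs, -, -, -, -, -, -⟩ := grid_bounds hc hθ0 hθ1 hγ hb hε hS hB hx hY (rfl : xs + (b + c) * (k s + 2) = _)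
  have hp := eps_pos hc hθ0 hε
  set it := k t + 1 - a t with hit
  have hitK : it ≤ K := by have := hks t ht; omega
  -- η_t: positive, ≤ b, and ≤ W(i_t) when t ≥ 1
  have hη : 0 < η t ∧ η t ≤ b ∧ (t ≠ 0 → η t ≤ W it) := by
    cases t with
    | zero => rw [hη0]; exact ⟨hb, le_rfl, fun h => absurd rfl h⟩
    | succ t₁ =>
      rw [hηs]
      refine ⟨hp _, hεb _ (by omega), fun _ => ?_⟩
      have hk1 := hak t₁ (by omega)
      exact eps_le_W hc hθ0 hε hW (by omega) (by omega)
  obtain ⟨hηpos, hηb, hηW⟩ := hη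
  have hyt : xs ≤ yB it := (hBbd it).1
  have hyt' : yB it + η t ≤ Ytop := by linarith [(hBbd it).2]
  -- the threshold gap in the coupling variable
  have hgap : 1 ≤ L t * (1 / Real.sqrt (yB it) - q t) := by
    rw [hq, hL, ← hit]
    have hcube := abs_sub_le_cube_mul_abs_invSqrt_sub (hxs.trans_le hyt) (by linarith : 0 < yB it + η t) (by linarith) hyt'
    rw [show yB it - (yB it + η t) = -η t by ring, abs_neg, abs_of_pos hηpos] at hcube
    have hmono : 1 / Real.sqrt (yB it + η t) ≤ 1 / Real.sqrt (yB it) :=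
      one_div_le_one_div_of_le (Real.sqrt_pos.mpr (hxs.trans_le hyt)) (Real.sqrt_le_sqrt (by linarith))
    rw [abs_of_nonneg (by linarith)] at hcube
    rw [div_mul_eq_mul_div, le_div_iff₀ hηpos, one_mul]
    exact hcube
  have hYtop0 : 0 ≤ 1 + Ytop := by rw [hT, hx]; positivity
  have hLpos : 0 ≤ L t := by rw [hL]; exact div_nonneg (pow_nonneg hYtop0 3) hηpos.le
  -- reads 1: recursion value ≤ yB(i_t)
  have hone : ∀ y, xs ≤ y → y ≤ yB it → min 1 (max 0 (L t * (1 / Real.sqrt y - q t))) = 1 := by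
    intro y hy0 hy1
    refine step_eq_one (hgap.trans (mul_le_mul_of_nonneg_left ?_ hLpos))
    have : 1 / Real.sqrt (yB it) ≤ 1 / Real.sqrt y :=
      one_div_le_one_div_of_le (Real.sqrt_pos.mpr (hxs.trans_le hy0)) (Real.sqrt_le_sqrt hy1)
    linarith
  -- reads 0: recursion value ≥ yB(i_t) + η_t
  have hzero : ∀ y, yB it + η t ≤ y → min 1 (max 0 (L t * (1 / Real.sqrt y - q t))) = 0 := by
    intro y hy
    refine step_eq_zero hLpos ?_
    rw [hq, ← hit]
    exact one_div_le_one_div_of_le (Real.sqrt_pos.mpr (by linarith)) (Real.sqrt_le_sqrt hy)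
  refine ⟨fun i hi => ⟨?_, ?_⟩, fun i hi => ⟨?_, ?_⟩⟩
  · rw [hgA]; exact hone _ (hAbd i).1 ((hAanti it i hi).trans (by linarith [hAB it hitK]))
  · rw [hgB]; exact hone _ (hBbd i).1 (hBanti it i hi)
  · have ht0 : t ≠ 0 := by rintro rfl; omega
    rw [hgA]; refine hzero _ ?_
    have h1 := hAanti i (it - 1) (by omega)
    have h2 := hcross (it - 1)
    rw [show it - 1 + 1 = it by omega] at h2
    linarith [hηW ht0]
  · have ht0 : t ≠ 0 := by rintro rfl; omega
    rw [hgB]; refine hzero _ ?_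
    have h1 := hBanti i (it - 1) (by omega)
    have h2 := hcross (it - 1)
    rw [show it - 1 + 1 = it by omega] at h2
    have h3 := hAB (it - 1) (by omega)
    linarith [hηW ht0]

end Summit.QuantumFields.BalabanUV.Beta.EriceRemainderEnclosureHistoryRenewalWitnessMonotone

end
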